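import Literature.NumberTheory.EllipticCurves.BurungaleCastellaSkinnerTian2022.CMPConverse
import HarnessLib

/-!
# Rational `2`-torsion on the CM curves with `K ∈ {ℚ(√−7), ℚ(i), ℚ(√−2)}` (and `j = 54000`):
# Burungale–Castella–Skinner–Tian 2022, Remark D, as a THEOREM — Corollary B is vacuous at `p = 2`

HONEST FRAMING (cell `b2b-bsdres`, run/shared/lean/b2b/bsd-rank1-residual/, verbatim in every
file): the goal of the cell is to DELETE the COMBINATION-SHAPED residual classes of the
Birch–Swinnerton-Dyer formula for ALL analytic-rank `≤ 1` elliptic curves over `ℚ` — "full BSD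
formula for every rank `≤ 1` curve in class `C`" assembled STRICTLY from published theorems — so
that the rank-`≤ 1` remainder becomes exactly the CONSTRUCTION-SHAPED classes, which are TYPED
(missing-input `Prop`s), NOT attempted. This is not "finishing BSD". Literature typer seat
`b2b-bsdres-lit-bst` (source: Burungale–Skinner–Tian / Burungale–Castella–Skinner–Tian; brief:
"the `p = 2, 3` and CM corner statements identified precisely"), gen 5. THEOREMS ONLY (no
definition, no named fact, no axiom, no table lookup, no certificate): elementary algebra of the
Weierstrass equation. Nothing is booked; no label and no census number moves; class X12 REMAINS
CONSTRUCTION-SHAPED.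

## What is proved

Burungale–Castella–Skinner–Tian, Ann. Math. Québec **46** (2022), Remark D (p. 327), names "the
main hindrance" to a rank-one CM `2`-converse useful for Goldfeld's conjecture: "`ℚ(√−7)` is the
only imaginary quadratic field of class number `1` with `2` split, and incidentally
`E(ℚ)[2] ≃ ℤ/2ℤ` for all elliptic curves `E/ℚ` with CM by `ℚ(√−7)` (see e.g. the table in
[38, p. 2])" — so hypothesis (i) "`E(ℚ)[p] = 0`" of their Corollary B (the mod-`p` criterion,
kernel theorem `X12.corB` of `X12/CMModPCriterion.lean`) FAILS at `p = 2` for every curve in the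
scope of Theorem A at `p = 2` (good ordinary at `2` forces `K = ℚ(√−7)`, gen-0 corner theorem
`cmFieldDiscrOfJ_eq_of_goodOrd_two`). The first half of Remark D is the gen-0 theorem
`cmFieldDiscrOfJ_eq_of_cmSplit_two`; this file proves the second half WITHOUT the table:

* `exists_twoTorsion_of_j_eq_neg_3375`, `exists_twoTorsion_of_j_eq_16581375`: over ANY field of
  characteristic `0`, every elliptic curve with `j ∈ {−3375, 16581375}` (= `−15³, 255³`, the two
  `j`-invariants with CM by an order of `ℚ(√−7)`) has a rational point `P ≠ O` with `2P = O`;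
  likewise `j = 1728, 287496` (`K = ℚ(i)`), `j = 8000` (`K = ℚ(√−2)`), `j = 54000` (the order
  `ℤ[√−3]`). (For `j ∈ {−12288000, −32768, −884736, …}` the same cubic has NO rational root, and
  for `j = 0` the answer depends on the sextic twist — neither is claimed here.)
* `exists_twoTorsion_of_cmFieldDiscrOfJ_eq_neg_seven` (`d_K = −7`), `…_eq_neg_four`, `…_eq_neg_eight`:
  the same over `ℚ` in the cell's vocabulary `cmFieldDiscrOfJ` (`Rank1Residual/Predicates.lean`).
* `exists_twoTorsion_of_hasCM_of_goodOrd_two`: a CM curve `E/ℚ` with good ordinary reduction at `2`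
  has a rational point of order `2` (granted Deuring's criterion `hDeu`, the tree's named fact
  `deuring_not_hasUnitRootAt_of_hasCM_of_not_cmSplit`, exactly as in the gen-0 corner theorems);
  `corB_hypothesis_i_fails_at_two`: WITH hypothesis (i) of Corollary B at `p = 2` the hypotheses
  are contradictory — Corollary B is a statement about ODD `p` (where (i) is automatic:
  `X12.noPTorsion_of_hasCM_of_goodOrd`, gen 2).

## Proof (elementary; Silverman AEC III §1)

For a Weierstrass curve `E : y² + a₁xy + a₃y = x³ + a₂x² + a₄x + a₆` over a field `F` with
`char F = 0`, a point `P = (x, y)` satisfies `P = −P = (x, −y − a₁x − a₃)` iff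
`2y + a₁x + a₃ = 0`, and then the Weierstrass equation reads `4x³ + b₂x² + 2b₄x + b₆ = 0`
(`two_torsion_of_bCubic_root`). The substitution `x = (X − 3b₂)/36` turns this cubic into
`(X³ − 27c₄X − 54c₆)/11664` (`bCubic_root_of_cCubic_root`; AEC III §1, the passage to
`y² = x³ − 27c₄x − 54c₆`). If `j = j(E) ∉ {0, 1728}` then `c₄ ≠ 0 ≠ c₆`, and from `j·Δ = c₄³`,
`1728Δ = c₄³ − c₆²` one gets `a·c₆² = c₄³` with `a := j/(j − 1728)`; hence with `d := c₆/c₄`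
we have `(c₄, c₆) = (d²a, d³a)` and `X = d·Y` transforms `X³ − 27c₄X − 54c₆` into
`d³a⁻¹… = (c₆³/c₄³)·(Y³ − 27aY − 54a)` (`cCubic_root_of_j_eq`). So EVERY curve with `j`-invariant
`j₀` has a rational `2`-torsion point as soon as the one cubic `Y³ − 27aY − 54a`,
`a = j₀/(j₀ − 1728)`, has a rational root `Y₀` — and it does: `(j₀, a, Y₀) =
(−3375, 125/189, 5)`, `(16581375, 614125/614061, −170/57)`, `(8000, 125/98, −30/7)`,
`(287496, 1331/1323, −22/7)`, `(54000, 125/121, −30/11)` (`norm_num`); for `j₀ = 1728`, `c₆ = 0`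
and `X = 0` is a root. (For `j₀ = −3375` the cofactor `Y² + 5Y + 25 − 27a` has discriminant
`−25/7 < 0`, so the rational `2`-torsion is EXACTLY `ℤ/2ℤ`, as Remark D says; that refinement is
not needed for the vacuity of (i) and is not proved here.)

## References
* A. Burungale, F. Castella, C. Skinner, Y. Tian, Ann. Math. Québec 46 (2022) 325–346, Rem. D
  (p. 327), Cor. B (p. 327), Thm. A (p. 326). [BurungaleCastellaSkinnerTian2022]
* J. H. Silverman, *The Arithmetic of Elliptic Curves*, 2nd ed., GTM 106 (2009), III §1
  (`b`- and `c`-invariants; `y² = 4x³ + b₂x² + 2b₄x + b₆`, `y² = x³ − 27c₄x − 54c₆`), III.2.3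
  (negation formula), App. A §3 / C §11 (CM `j`-invariants). [SilvermanAEC2009]
-/

set_option autoImplicit false

open WeierstrassCurve Literature.NumberTheory.EllipticCurves
  Literature.NumberTheory.EllipticCurves.Rank1Residual
  Literature.NumberTheory.EllipticCurves.BurungaleCastellaSkinnerTian2022

namespace Summit.BirchSwinnertonDyer.Rank1Residual.X12

/-! ### Over any field of characteristic `0` -/

section AnyField

variable {F : Type*} [Field F] (W : WeierstrassCurve F)

/-- A root `x` of the `2`-division cubic `4x³ + b₂x² + 2b₄x + b₆` is the abscissa of a rational
point `P = (x, −(a₁x + a₃)/2)` of order `2` (`P ≠ O`, `2P = O`), on any elliptic curve over a field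
of characteristic `0`. [cite: SilvermanAEC2009, III §1 and III.2.3] -/
theorem exists_twoTorsion_of_bCubic_root [DecidableEq F] [CharZero F] [W.IsElliptic] (x : F)
    (hx : 4 * x ^ 3 + W.b₂ * x ^ 2 + 2 * W.b₄ * x + W.b₆ = 0) :
    ∃ P : W.toAffine.Point, P ≠ 0 ∧ 2 • P = 0 := by
  set y : F := -(W.a₁ * x + W.a₃) / 2 with hy
  have heq : W.toAffine.Equation x y := by
    rw [Affine.equation_iff']
    simp only [b₂, b₄, b₆] at hx
    rw [hy]
    linear_combination (-(1 : F) / 4) * hx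
  have hns : W.toAffine.Nonsingular x y := (Affine.equation_iff_nonsingular (W := W)).mp heq
  refine ⟨.some x y hns, Affine.Point.some_ne_zero hns, ?_⟩
  rw [two_nsmul]
  exact Affine.Point.add_self_of_Y_eq (by rw [Affine.negY, hy]; ring)

/-- The substitution `x = (X − 3b₂)/36` (Silverman AEC III §1): a root `X` of
`X³ − 27c₄X − 54c₆` gives the root `(X − 3b₂)/36` of `4x³ + b₂x² + 2b₄x + b₆`, since
`11664·(4x³ + b₂x² + 2b₄x + b₆) = X³ − 27c₄X − 54c₆`. [cite: SilvermanAEC2009, III §1] -/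
theorem bCubic_root_of_cCubic_root [CharZero F] (X : F) (hX : X ^ 3 - 27 * W.c₄ * X - 54 * W.c₆ = 0) :
    4 * ((X - 3 * W.b₂) / 36) ^ 3 + W.b₂ * ((X - 3 * W.b₂) / 36) ^ 2 +
      2 * W.b₄ * ((X - 3 * W.b₂) / 36) + W.b₆ = 0 := by
  simp only [c₄, c₆] at hX
  linear_combination ((1 : F) / 11664) * hX

/-- Hence a root of `X³ − 27c₄X − 54c₆` gives a rational point of order `2`.
[cite: SilvermanAEC2009, III §1 and III.2.3] -/
theorem exists_twoTorsion_of_cCubic_root [DecidableEq F] [CharZero F] [W.IsElliptic] (X : F)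
    (hX : X ^ 3 - 27 * W.c₄ * X - 54 * W.c₆ = 0) :
    ∃ P : W.toAffine.Point, P ≠ 0 ∧ 2 • P = 0 :=
  exists_twoTorsion_of_bCubic_root W _ (bCubic_root_of_cCubic_root W X hX)

/-- `j·Δ = c₄³` for an elliptic curve over a field. [cite: SilvermanAEC2009, III §1] -/
theorem j_mul_Δ_eq [W.IsElliptic] : W.j * W.Δ = W.c₄ ^ 3 := by
  have hΔ : W.Δ ≠ 0 := W.coe_Δ' ▸ W.Δ'.ne_zero
  rw [j, Units.val_inv_eq_inv_val, coe_Δ']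
  field_simp

/-- **The `j`-parametrisation of the `2`-division cubic.** If `j(E) = j₀ ∉ {0, 1728}` and
`a·(j₀ − 1728) = j₀`, then `a·c₆² = c₄³` (so `(c₄, c₆) = (d²a, d³a)` with `d = c₆/c₄`), and for
every root `Y₀` of `Y³ − 27aY − 54a` the element `X = (c₆/c₄)·Y₀` is a root of
`X³ − 27c₄X − 54c₆`. Any field. [cite: SilvermanAEC2009, III §1 (c-relations, j = c₄³/Δ)] -/
theorem cCubic_root_of_j_eq [W.IsElliptic] {j₀ a Y₀ : F} (hj : W.j = j₀) (h0 : j₀ ≠ 0)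
    (h1728 : j₀ ≠ 1728) (ha : a * (j₀ - 1728) = j₀)
    (hY : Y₀ ^ 3 - 27 * a * Y₀ - 54 * a = 0) :
    ∃ X : F, X ^ 3 - 27 * W.c₄ * X - 54 * W.c₆ = 0 := by
  have hΔ : W.Δ ≠ 0 := W.coe_Δ' ▸ W.Δ'.ne_zero
  have hjΔ : j₀ * W.Δ = W.c₄ ^ 3 := hj ▸ j_mul_Δ_eq W
  have hrel : 1728 * W.Δ = W.c₄ ^ 3 - W.c₆ ^ 2 := W.c_relation
  have hc4 : W.c₄ ≠ 0 := by
    intro h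
    exact h0 (by rw [← hj]; exact W.j_eq_zero h)
  have hc6 : W.c₆ ≠ 0 := by
    intro h
    apply h1728
    have : (j₀ - 1728) * W.Δ = 0 := by
      linear_combination hjΔ - hrel + W.c₆ * h
    rcases mul_eq_zero.mp this with h' | h'
    · exact (sub_eq_zero.mp h')
    · exact absurd h' hΔ
  have key : a * W.c₆ ^ 2 = W.c₄ ^ 3 := by
    linear_combination W.Δ * ha - (a - 1) * hjΔ + a * hrel
  refine ⟨W.c₆ / W.c₄ * Y₀, ?_⟩
  have hXc : W.c₄ * (W.c₆ / W.c₄ * Y₀) = W.c₆ * Y₀ := by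
    field_simp
  set X := W.c₆ / W.c₄ * Y₀ with hXdef
  have h3 : W.c₄ ^ 3 * (X ^ 3 - 27 * W.c₄ * X - 54 * W.c₆) = 0 := by
    linear_combination
      ((W.c₄ * X) ^ 2 + W.c₄ * X * (W.c₆ * Y₀) + (W.c₆ * Y₀) ^ 2 - 27 * W.c₄ ^ 3) * hXc +
        W.c₆ ^ 3 * hY + (27 * W.c₆ * Y₀ + 54 * W.c₆) * key
  rcases mul_eq_zero.mp h3 with h' | h'
  · exact absurd h' (pow_ne_zero 3 hc4)
  · exact h'

/-- If `j(E) = j₀ ∉ {0, 1728}`, `a·(j₀ − 1728) = j₀` and `Y³ − 27aY − 54a` has a root in `F`,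
then `E` has a rational point of order `2`. [cite: SilvermanAEC2009, III §1 and III.2.3] -/
theorem exists_twoTorsion_of_j_eq [DecidableEq F] [CharZero F] [W.IsElliptic] {j₀ a Y₀ : F} (hj : W.j = j₀) (h0 : j₀ ≠ 0)
    (h1728 : j₀ ≠ 1728) (ha : a * (j₀ - 1728) = j₀)
    (hY : Y₀ ^ 3 - 27 * a * Y₀ - 54 * a = 0) :
    ∃ P : W.toAffine.Point, P ≠ 0 ∧ 2 • P = 0 := by
  obtain ⟨X, hX⟩ := cCubic_root_of_j_eq W hj h0 h1728 ha hY
  exact exists_twoTorsion_of_cCubic_root W X hX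

/-- **`j = −3375 = −15³`** (CM by `ℤ[(1+√−7)/2]`; `49a1` and its quadratic twists): a rational
point of order `2` on every such curve (`a = 125/189`, `Y₀ = 5`).
[cite: BurungaleCastellaSkinnerTian2022, Rem. D (p. 327)] [cite: SilvermanAEC2009, App. A §3] -/
theorem exists_twoTorsion_of_j_eq_neg_3375 [DecidableEq F] [CharZero F] [W.IsElliptic] (hj : W.j = -3375) :
    ∃ P : W.toAffine.Point, P ≠ 0 ∧ 2 • P = 0 :=
  exists_twoTorsion_of_j_eq W (a := 125 / 189) (Y₀ := 5) hj (by norm_num) (by norm_num)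
    (by norm_num) (by norm_num)

/-- **`j = 16581375 = 255³`** (CM by the order `ℤ[√−7]` of conductor `2`; `49a2` and its
quadratic twists): a rational point of order `2` on every such curve (`a = 614125/614061`,
`Y₀ = −170/57`). [cite: BurungaleCastellaSkinnerTian2022, Rem. D (p. 327)]
[cite: SilvermanAEC2009, App. A §3] -/
theorem exists_twoTorsion_of_j_eq_16581375 [DecidableEq F] [CharZero F] [W.IsElliptic] (hj : W.j = 16581375) :
    ∃ P : W.toAffine.Point, P ≠ 0 ∧ 2 • P = 0 :=
  exists_twoTorsion_of_j_eq W (a := 614125 / 614061) (Y₀ := -170 / 57) hj (by norm_num)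
    (by norm_num) (by norm_num) (by norm_num)

/-- **`j = 8000 = 20³`** (CM by `ℤ[√−2]`; `256a1` and its twists): a rational point of order `2`
(`a = 125/98`, `Y₀ = −30/7`). [cite: SilvermanAEC2009, App. A §3] -/
theorem exists_twoTorsion_of_j_eq_8000 [DecidableEq F] [CharZero F] [W.IsElliptic] (hj : W.j = 8000) :
    ∃ P : W.toAffine.Point, P ≠ 0 ∧ 2 • P = 0 :=
  exists_twoTorsion_of_j_eq W (a := 125 / 98) (Y₀ := -30 / 7) hj (by norm_num) (by norm_num)
    (by norm_num) (by norm_num)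

/-- **`j = 287496 = 66³`** (CM by `ℤ[2i]`; `32a`-type twists): a rational point of order `2`
(`a = 1331/1323`, `Y₀ = −22/7`). [cite: SilvermanAEC2009, App. A §3] -/
theorem exists_twoTorsion_of_j_eq_287496 [DecidableEq F] [CharZero F] [W.IsElliptic] (hj : W.j = 287496) :
    ∃ P : W.toAffine.Point, P ≠ 0 ∧ 2 • P = 0 :=
  exists_twoTorsion_of_j_eq W (a := 1331 / 1323) (Y₀ := -22 / 7) hj (by norm_num) (by norm_num)
    (by norm_num) (by norm_num)

/-- **`j = 54000 = 2·30³`** (CM by `ℤ[√−3]`; `36a`-type twists): a rational point of order `2`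
(`a = 125/121`, `Y₀ = −30/11`). [cite: SilvermanAEC2009, App. A §3] -/
theorem exists_twoTorsion_of_j_eq_54000 [DecidableEq F] [CharZero F] [W.IsElliptic] (hj : W.j = 54000) :
    ∃ P : W.toAffine.Point, P ≠ 0 ∧ 2 • P = 0 :=
  exists_twoTorsion_of_j_eq W (a := 125 / 121) (Y₀ := -30 / 11) hj (by norm_num) (by norm_num)
    (by norm_num) (by norm_num)

/-- **`j = 1728 = 12³`** (CM by `ℤ[i]`; the curves `y² = x³ + Dx`): `c₆ = 0`, so `X = 0` is a
root of `X³ − 27c₄X − 54c₆` and there is a rational point of order `2`.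
[cite: SilvermanAEC2009, III §1 and App. A §3] -/
theorem exists_twoTorsion_of_j_eq_1728 [DecidableEq F] [CharZero F] [W.IsElliptic] (hj : W.j = 1728) :
    ∃ P : W.toAffine.Point, P ≠ 0 ∧ 2 • P = 0 := by
  have hjΔ : 1728 * W.Δ = W.c₄ ^ 3 := hj ▸ j_mul_Δ_eq W
  have hrel : 1728 * W.Δ = W.c₄ ^ 3 - W.c₆ ^ 2 := W.c_relation
  have hc6 : W.c₆ = 0 := by
    have : W.c₆ ^ 2 = 0 := by linear_combination hrel - hjΔ
    exact pow_eq_zero_iff two_ne_zero |>.mp this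
  exact exists_twoTorsion_of_cCubic_root W 0 (by rw [hc6]; ring)

end AnyField

/-! ### Over `ℚ`, in the cell's CM vocabulary -/

section OverRat

variable (W : WeierstrassCurve ℚ) [W.IsElliptic]

/-- `d_K = −7` in the cell's table `cmFieldDiscrOfJ` means `j ∈ {−3375, 16581375}`.
[cite: SilvermanATAEC1994, App. A §3 (table of CM j-invariants)] -/
theorem j_eq_of_cmFieldDiscrOfJ_eq_neg_seven {j : ℚ} (h : cmFieldDiscrOfJ j = -7) :
    j = -3375 ∨ j = 16581375 := by
  unfold cmFieldDiscrOfJ at h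
  split_ifs at h <;> first | assumption | omega

/-- `d_K = −4` means `j ∈ {1728, 287496}`. [cite: SilvermanATAEC1994, App. A §3] -/
theorem j_eq_of_cmFieldDiscrOfJ_eq_neg_four {j : ℚ} (h : cmFieldDiscrOfJ j = -4) :
    j = 1728 ∨ j = 287496 := by
  unfold cmFieldDiscrOfJ at h
  split_ifs at h <;> first | assumption | omega

/-- `d_K = −8` means `j = 8000`. [cite: SilvermanATAEC1994, App. A §3] -/
theorem j_eq_of_cmFieldDiscrOfJ_eq_neg_eight {j : ℚ} (h : cmFieldDiscrOfJ j = -8) :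
    j = 8000 := by
  unfold cmFieldDiscrOfJ at h
  split_ifs at h <;> first | assumption | omega

/-- **BCST 2022, Remark D (second half), as a theorem.** Every elliptic curve `E/ℚ` with CM by
(an order of) `K = ℚ(√−7)` — `d_K = −7`, i.e. `j(E) ∈ {−3375, 16581375}` — has a rational point
of order `2`: `E(ℚ)[2] ≠ 0`. (Remark D: "`E(ℚ)[2] ≃ ℤ/2ℤ` for all elliptic curves `E/ℚ` with CM
by `ℚ(√−7)` (see e.g. the table in [38, p. 2])"; proved here from the Weierstrass equation, no
table.) [cite: BurungaleCastellaSkinnerTian2022, Rem. D (p. 327)] -/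
theorem exists_twoTorsion_of_cmFieldDiscrOfJ_eq_neg_seven (h : cmFieldDiscrOfJ W.j = -7) :
    ∃ P : W.toAffine.Point, P ≠ 0 ∧ 2 • P = 0 := by
  rcases j_eq_of_cmFieldDiscrOfJ_eq_neg_seven h with hj | hj
  · exact exists_twoTorsion_of_j_eq_neg_3375 W hj
  · exact exists_twoTorsion_of_j_eq_16581375 W hj

/-- Every elliptic curve `E/ℚ` with CM by an order of `ℚ(i)` (`d_K = −4`: `j ∈ {1728, 287496}`)
has a rational point of order `2`. [cite: SilvermanAEC2009, App. A §3] -/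
theorem exists_twoTorsion_of_cmFieldDiscrOfJ_eq_neg_four (h : cmFieldDiscrOfJ W.j = -4) :
    ∃ P : W.toAffine.Point, P ≠ 0 ∧ 2 • P = 0 := by
  rcases j_eq_of_cmFieldDiscrOfJ_eq_neg_four h with hj | hj
  · exact exists_twoTorsion_of_j_eq_1728 W hj
  · exact exists_twoTorsion_of_j_eq_287496 W hj

/-- Every elliptic curve `E/ℚ` with CM by `ℤ[√−2]` (`d_K = −8`: `j = 8000`) has a rational point of
order `2`. [cite: SilvermanAEC2009, App. A §3] -/
theorem exists_twoTorsion_of_cmFieldDiscrOfJ_eq_neg_eight (h : cmFieldDiscrOfJ W.j = -8) :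
    ∃ P : W.toAffine.Point, P ≠ 0 ∧ 2 • P = 0 :=
  exists_twoTorsion_of_j_eq_8000 W (j_eq_of_cmFieldDiscrOfJ_eq_neg_eight h)

/-- **The `p = 2` corner of Theorem A carries rational `2`-torsion.** A CM curve `E/ℚ` with GOOD
ORDINARY reduction at `2` (the scope of BCST Theorem A / Corollary B at `p = 2`) has `K = ℚ(√−7)`
(gen-0 corner theorem `cmFieldDiscrOfJ_eq_of_goodOrd_two`, from Deuring's criterion `hDeu`) and
hence a rational point `P ≠ O` with `2P = O`.
[cite: BurungaleCastellaSkinnerTian2022, Rem. D (p. 327), Thm. A (p. 326)]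
[cite: Lang1987, Ch. 13 §4 Thm. 12] -/
theorem exists_twoTorsion_of_hasCM_of_goodOrd_two
    (hDeu : deuring_not_hasUnitRootAt_of_hasCM_of_not_cmSplit) [W.IsGloballyMinimal]
    (hCM : W.HasCM) [Fact (2 : ℕ).Prime] (hgood : W.HasGoodReductionAtPrime 2)
    (hord : ¬ ((2 : ℕ) : ℤ) ∣ W.frobeniusTrace 2) :
    ∃ P : W.toAffine.Point, P ≠ 0 ∧ 2 • P = 0 :=
  exists_twoTorsion_of_cmFieldDiscrOfJ_eq_neg_seven W
    (cmFieldDiscrOfJ_eq_of_goodOrd_two hDeu W hCM hgood hord)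

/-- **Corollary B is vacuous at `p = 2`.** In the scope of BCST Corollary B at `p = 2` (CM, good
ordinary at `2`), hypothesis (i) "`E(ℚ)[2] = 0`" — spelled exactly as the binder `htors` of
`X12.corB` (`∀ P, p • P = 0 → P = 0`) — is FALSE; so Corollary B is a statement about odd `p`
(where (i) is automatic: `X12.noPTorsion_of_hasCM_of_goodOrd`, `X12.corB_of_ne_two`).
[cite: BurungaleCastellaSkinnerTian2022, Cor. B and Rem. D (p. 327)]
[cite: Lang1987, Ch. 13 §4 Thm. 12] -/
theorem corB_hypothesis_i_fails_at_two
    (hDeu : deuring_not_hasUnitRootAt_of_hasCM_of_not_cmSplit) [W.IsGloballyMinimal]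
    (hCM : W.HasCM) [Fact (2 : ℕ).Prime] (hgood : W.HasGoodReductionAtPrime 2)
    (hord : ¬ ((2 : ℕ) : ℤ) ∣ W.frobeniusTrace 2)
    (htors : ∀ P : W.toAffine.Point, (2 : ℕ) • P = 0 → P = 0) : False := by
  obtain ⟨P, hP0, hP2⟩ := exists_twoTorsion_of_hasCM_of_goodOrd_two W hDeu hCM hgood hord
  exact hP0 (htors P hP2)

/-- The same without Deuring, on the `j`-side: NO elliptic curve over `ℚ` with `d_K = −7` has
`E(ℚ)[2] = 0`. [cite: BurungaleCastellaSkinnerTian2022, Rem. D (p. 327)] -/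
theorem not_noTwoTorsion_of_cmFieldDiscrOfJ_eq_neg_seven (h : cmFieldDiscrOfJ W.j = -7) :
    ¬ ∀ P : W.toAffine.Point, (2 : ℕ) • P = 0 → P = 0 := by
  intro htors
  obtain ⟨P, hP0, hP2⟩ := exists_twoTorsion_of_cmFieldDiscrOfJ_eq_neg_seven W h
  exact hP0 (htors P hP2)

end OverRat

end Summit.BirchSwinnertonDyer.Rank1Residual.X12
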